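import Summits.KontsevichZagierPeriods.KontsevichZagierPeriods.Theorems.LinRedNormalFormArrangementNormalFormStubRebaseSimpleZeroNestedDiffExpand

/-!
# Stub `stub_rebaseSimpleZeroTwo`, part `rebaseSimpleZero_nestedDifferent` (crux
`ArrangementNormalForm`, line `janus-bands`) — brick `NestedDiffWedge`

**The wedge estimate** (the analytic input of the NON-dominated configurations of the edge
expansion). If two linearly independent affine forms `Λ₁, Λ₂` on `ℝ³` (read as two coordinates
of an invertible linear map `f`, shifted) bound a function by `|φ| ≤ K/(√|Λ₁| √|Λ₂|)` on a set
`W` bounded in the `f`-coordinates, then `φ` is absolutely integrable on `W`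
(`RebaseDiff.integrableOn_wedge`, registered as `rebaseSimpleZero_wedgeEstimate`): the dominator
is the pull-back along `f` of a product of one-variable integrable functions
(`RebaseNest.exists_dominator`), and Lebesgue measure is rescaled by `|det f|⁻¹` under `f`
(`Real.map_linearMap_volume_pi_eq_smul_volume_pi`). This generalises the cone estimate
`RebaseNest.integrableOn_cone` (forms `t₁ − t₀`, `t₂ − t₀`) to arbitrary independent forms; it
is what makes the pieces of the edge expansion converge when the wall TOUCHES the piece along an
edge (`|R| ≥ 2√((S − tⱼ)(tⱼ − tᵢ))` on `{tᵢ < tⱼ < S}` when the wall is the section `S`) or at a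
corner (`|R| ≥ c √(|L₁| |L₂|)` on a sector between two cuts `L₁, L₂` through the corner).

References: M. Kontsevich, D. Zagier, *Periods* (2001), §1.2.
-/

noncomputable section

open Set MeasureTheory MvPolynomial
open Literature.NumberTheory.Transcendental Literature.ModelTheory.ExponentialFields

namespace Summit.KontsevichZagierPeriods.ArrangementNormalForm.JanusBands

namespace RebaseDiff

open SeparatePos RebasePos RebaseZero RebaseNest

/-- The preimage of a coordinate hyperplane under an invertible linear map is null (the
hyperplane itself is null: `Measure.pi_hyperplane`, cf. `KernelIntegrable.volume_coord_eq` in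
`…UnfoldedStokesHyperellipticRiemannRelationStubKernelIntegrableAux`). -/
theorem volume_preimage_coord_eq (f : (Fin 3 → ℝ) →ₗ[ℝ] (Fin 3 → ℝ)) (hf : LinearMap.det f ≠ 0) (k : Fin 3)
    (a : ℝ) : volume {z : Fin 3 → ℝ | f z k = a} = 0 := by
  have h0 : volume {w : Fin 3 → ℝ | w k = a} = 0 := by
    rw [volume_pi]
    exact Measure.pi_hyperplane (fun _ : Fin 3 => (volume : Measure ℝ)) k a
  have h := Measure.addHaar_preimage_linearMap (volume : Measure (Fin 3 → ℝ)) hf {w : Fin 3 → ℝ | w k = a}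
  rw [h0, mul_zero] at h
  exact h

/-- **The wedge estimate.** Let `f` be an invertible linear map of `ℝ³`. If on a measurable set `W`
the `f`-coordinates are bounded (`|f z 0| ≤ R`, `|f z 1 − a| ≤ R`, `|f z 2 − b| ≤ R`) and a function
`φ`, a.e.-strongly measurable on `W`, satisfies `|φ z| ≤ K/(√|f z 1 − a| · √|f z 2 − b|)` off the
two planes `f z 1 = a`, `f z 2 = b`, then `φ` is absolutely integrable on `W`. [folklore] -/
theorem integrableOn_wedge {φ : (Fin 3 → ℝ) → ℝ} {W : Set (Fin 3 → ℝ)} (hWm : MeasurableSet W)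
    (hφ : AEStronglyMeasurable φ (volume.restrict W)) (f : (Fin 3 → ℝ) →ₗ[ℝ] (Fin 3 → ℝ))
    (hf : LinearMap.det f ≠ 0) (a b K R : ℝ)
    (hR : ∀ z ∈ W, |f z 0| ≤ R ∧ |f z 1 - a| ≤ R ∧ |f z 2 - b| ≤ R)
    (hK : ∀ z ∈ W, f z 1 ≠ a → f z 2 ≠ b → |φ z| ≤ K / (Real.sqrt |f z 1 - a| * Real.sqrt |f z 2 - b|)) :
    IntegrableOn φ W := by
  obtain ⟨F, hFi, hF⟩ := exists_dominator (R + 1)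
  -- the dominator in the `f`-coordinates: a product of one-variable integrable functions
  set g : Fin 3 → ℝ → ℝ := ![(Icc (-R) R).indicator fun _ => 1, fun t => F (t - a), fun t => F (t - b)] with hg
  have hgi : ∀ l, Integrable (g l) := by
    refine Fin.forall_fin_succ.2 ⟨?_, Fin.forall_fin_two.2 ⟨hFi.comp_sub_right a, hFi.comp_sub_right b⟩⟩
    exact (integrableOn_const (s := Icc (-R) R) (C := (1 : ℝ)) (μ := volume)
      (by rw [Real.volume_Icc]; exact ENNReal.ofReal_lt_top.ne)).integrable_indicator measurableSet_Icc
  set G : (Fin 3 → ℝ) → ℝ := fun w => |K| * ∏ l, g l (w l) with hG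
  have hGi : Integrable G := (Integrable.fintype_prod (μ := fun _ => volume) hgi).const_mul |K|
  -- pull back along `f`: Lebesgue measure is rescaled by `|det f|⁻¹`
  have hmap := Real.map_linearMap_volume_pi_eq_smul_volume_pi hf
  have hfm : AEMeasurable f (volume : Measure (Fin 3 → ℝ)) :=
    (LinearMap.continuous_on_pi f).measurable.aemeasurable
  have hGf : Integrable (G ∘ f) := by
    have h1 : Integrable G (Measure.map f volume) := by
      rw [hmap]; exact hGi.smul_measure ENNReal.ofReal_ne_top
    exact (integrable_map_measure h1.aestronglyMeasurable hfm).1 h1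
  -- domination off the two null planes
  refine Integrable.mono' hGf.integrableOn hφ ((ae_restrict_iff' hWm).2 ?_)
  have hN₁ : ∀ᵐ z : Fin 3 → ℝ, z ∉ {z : Fin 3 → ℝ | f z 1 = a} := compl_mem_ae_iff.2 (volume_preimage_coord_eq f hf 1 a)
  have hN₂ : ∀ᵐ z : Fin 3 → ℝ, z ∉ {z : Fin 3 → ℝ | f z 2 = b} := compl_mem_ae_iff.2 (volume_preimage_coord_eq f hf 2 b)
  filter_upwards [hN₁, hN₂] with z hz1 hz2 hz
  obtain ⟨h0, h1, h2⟩ := hR z hz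
  have hp1 : 0 < |f z 1 - a| := abs_pos.2 (sub_ne_zero.2 hz1)
  have hp2 : 0 < |f z 2 - b| := abs_pos.2 (sub_ne_zero.2 hz2)
  have hIcc : f z 0 ∈ Icc (-R) R := ⟨(abs_le.1 h0).1, (abs_le.1 h0).2⟩
  rw [Real.norm_eq_abs, Function.comp_apply, hG]
  dsimp only
  rw [Fin.prod_univ_three]
  simp only [hg, Matrix.cons_val_zero, Matrix.cons_val_one, Matrix.cons_val_two, Matrix.head_cons,
    Matrix.tail_cons, indicator_of_mem hIcc, hF _ hp1 (by linarith), hF _ hp2 (by linarith), one_mul]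
  calc |φ z| ≤ K / (Real.sqrt |f z 1 - a| * Real.sqrt |f z 2 - b|) := hK z hz hz1 hz2
    _ ≤ |K| / (Real.sqrt |f z 1 - a| * Real.sqrt |f z 2 - b|) :=
        div_le_div_of_nonneg_right (le_abs_self K) (by positivity)
    _ = |K| * ((Real.sqrt |f z 1 - a|)⁻¹ * (Real.sqrt |f z 2 - b|)⁻¹) := by
        rw [div_eq_mul_inv, mul_inv]

end RebaseDiff

/-- **Registered brick `rebaseSimpleZero_wedgeEstimate` of the part `rebaseSimpleZero_nestedDifferent`
(stub `stub_rebaseSimpleZeroTwo`, line `janus-bands`): the wedge estimate.** For an invertible linear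
map `f` of `ℝ³`, a measurable set `W` bounded in the `f`-coordinates and a function `φ`,
a.e.-strongly measurable on `W`, with `|φ z| ≤ K/(√|f z 1 − a| · √|f z 2 − b|)` off the planes
`f z 1 = a`, `f z 2 = b`, the function `φ` is absolutely integrable on `W`
(`RebaseDiff.integrableOn_wedge`: pull-back of a product dominator, Lebesgue measure rescaled by
`|det f|⁻¹`). This is the convergence input for the pieces of the edge expansion whose wall touches
the piece along an edge or at a corner. [folklore] -/
theorem rebaseSimpleZero_wedgeEstimate (φ : (Fin 3 → ℝ) → ℝ) (W : Set (Fin 3 → ℝ)) (hWm : MeasurableSet W) (hφ : MeasureTheory.AEStronglyMeasurable φ (MeasureTheory.volume.restrict W)) (f : (Fin 3 → ℝ) →ₗ[ℝ] (Fin 3 → ℝ)) (hf : LinearMap.det f ≠ 0) (a b K R : ℝ) (hR : ∀ z ∈ W, |f z 0| ≤ R ∧ |f z 1 - a| ≤ R ∧ |f z 2 - b| ≤ R) (hK : ∀ z ∈ W, f z 1 ≠ a → f z 2 ≠ b → |φ z| ≤ K / (Real.sqrt |f z 1 - a| * Real.sqrt |f z 2 - b|)) : MeasureTheory.IntegrableOn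 φ W :=
  RebaseDiff.integrableOn_wedge hWm hφ f hf a b K R hR hK

end Summit.KontsevichZagierPeriods.ArrangementNormalForm.JanusBands
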